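import Summits.ResolutionOfSingularities.ResolutionOfSingularities.Theorems.WeightedInvariantJOpenPresentationCrossingStratum
import HarnessLib

/-!
# (open″)≤3 for the pair of record `(ι₃ᵗ, J₃ᵗ)` — THE STRATUM IFF AT A POINT WITH `τ = 0` (crossing `ε = 1` and isolated `ε = 0`
# alike): near a dimension-three position whose top `ι₀`-stratum is the closed point and whose tie letter vanishes, the value
# `ι₃ᵗ(𝔪)` is attained at `𝔪` only (door `HypersurfaceCentreConstruction`, stmt-ResolutionOfSingularities-19897; P3 rung clause h8
# `JOpenPresentationForallSingLE 3 p Iota3.iotaFlatT Iota3.jFlatT`, point bodies (P₁₀) = (o52-Bε1) and (P₀₀) = (o52-Bε0) of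
# res-L1-w43-plan-1's DEALER LINES #2 / BATCH 18:49Z, hand res-L1-w43-stub-3)

Topic: `Summits/ResolutionOfSingularities/ResolutionOfSingularities/Theorems`. Helper for the door item
`HypersurfaceCentreConstruction` (stmt-ResolutionOfSingularities-19897, route `WeightedInvariant`), line `local-engine`
(L W4.3), def-free.  Sequel of `…JOpenPresentationCrossingStratum` (`CrossingPoint.exists_stratumIff_crossing`, p557574): the same
spectrum argument (res-type-073's `StratumIff.stratumIff_of_strat` with `v = (ν ; ε)`, ideal forms from `husc_iotaOrd` and the
non-regular locus of the reduced `ν`-stratum) run under the hypothesis `τ(A_𝔪, F/1) = 0` instead of `ε = 1`, so that it serves the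
ISOLATED point body (P₀₀) (`ε = 0`, `τ = 0`) as well: at `ε(𝔪) = 0` the two superlevel sets are `{(ν ; ε) ≥ (ν₀ ; 0)} = V(I_{ν₀})` and
`{(ν ; ε) > (ν₀ ; 0)} = V(I_{ν₀+1} · J)`; the (strat) input uses (c7) for `τ` (`iotaTau_localization_mono`: a generization of a `τ = 0`
position has `τ = 0`).

* `iotaTau_localization_mono` — (c7) for `τ` in `A`-form (any ring).
* **`exists_stratumIff_of_iotaTau_eq_zero`** — `∃ h ∉ 𝔪, ∀ 𝔮 ∌ h, dim A_𝔮 ≤ 3: 𝔪 ≤ 𝔮 ↔ (F ∈ 𝔪_{A_𝔮}² ∧ ι₃ᵗ(A_𝔮) F = ι₃ᵗ(A_𝔪) F)`.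

[OURS · L1 W4.3 · (o52-Bε1)/(o52-Bε0)]  Replaces the role of NO printed item; NOT a statement of the manuscript
[claim: Hironaka2017, status: under-review]. AI work, weaker than expert review.  Pure commutative algebra; no named facts.

## References

* V. Cossart, O. Piltant, J. Algebra 320 (2008), Prop. 4.2 (proof). [CossartPiltant2008]
* H. Matsumura, *Commutative Ring Theory* (1987), §30 Cor. to Thm. 30.5, Thm. 13.5. [Matsumura1987]
-/

noncomputable section

open IsLocalRing Literature.AlgebraicGeometry.Resolution
open Summit.ResolutionOfSingularities.ResolutionOfSingularities.Cruxes.HypersurfaceCentreConstruction.LocalEngine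
open Summit.ResolutionOfSingularities.ResolutionOfSingularities.Cruxes.HypersurfaceCentreConstruction.LocalEngine.Iota3

set_option linter.dupNamespace false -- mandated namespace of this single-conjunct summit

namespace Summit.ResolutionOfSingularities.ResolutionOfSingularities.Theorems

namespace CrossingPoint

variable {A : Type} [CommRing A]

/-- **(c7) for `τ` in `A`-form**: `iotaTau` does not increase under generization among the primes of `A` (any ring; res-type-013's
`iotaTau_localization_le` transported through `(A_{𝔮'})_{𝔮} ≃ A_𝔮`). [OURS · L1 W4.3] -/
theorem iotaTau_localization_mono (F : A) (𝔮 𝔮' : Ideal A) [𝔮.IsPrime] [𝔮'.IsPrime] (hle : 𝔮 ≤ 𝔮') :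
    iotaTau (Localization.AtPrime 𝔮) (algebraMap A (Localization.AtPrime 𝔮) F) ≤
      iotaTau (Localization.AtPrime 𝔮') (algebraMap A (Localization.AtPrime 𝔮') F) := by
  obtain ⟨hprime, hcomap⟩ := StratumIff.isPrime_map_and_comap_map_eq 𝔮' 𝔮 hle
  haveI := hprime
  have h := iotaTau_localization_le (R := Localization.AtPrime 𝔮')
    (𝔮.map (algebraMap A (Localization.AtPrime 𝔮'))) (algebraMap A (Localization.AtPrime 𝔮') F)
  rwa [StratumIff.iota_localization_localization_eq iotaTau iotaTau_isoInvariant 𝔮' _ F,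
    StratumIff.iota_localization_congr iotaTau hcomap F] at h

/-- **THE STRATUM IFF OF (open″)≤3 AT A POINT WITH `τ = 0`** (CROSSING `ε = 1` and ISOLATED `ε = 0` alike).  `k` perfect, `A` of
finite type over `k`, `𝔪` a prime with `A_𝔪` regular of dimension `3`, `0 ≠ F/1 ∈ 𝔪² A_𝔪`, top `ι₀`-stratum of `(A_𝔪, F/1)` the closed
point, `τ(A_𝔪, F/1) = 0`.  Then some basic open `D(h) ∋ 𝔪` has: for every prime `𝔮 ∌ h` with `dim A_𝔮 ≤ 3`,
`𝔪 ≤ 𝔮 ↔ (F/1 ∈ 𝔪_{A_𝔮}² ∧ ι₃ᵗ(A_𝔮)(F) = ι₃ᵗ(A_𝔪)(F))` (same spectrum argument with `v = (ν ; ε)`: the two ideal forms are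
`V(I_{ν₀})` / `V(I_{ν₀+1} · J)` at `ε = 0` and `V(I_{ν₀+1} · J)` / `V(I_{ν₀+1})` at `ε = 1`; a generization with the same `(ν ; ε)` has
`τ = 0` by (c7) for `τ`).  The ι-side of the point bodies (P₁₀) CROSSING and (P₀₀) ISOLATED of res-D-brk-1's regime assembly.
[OURS · L1 W4.3 · (o52-Bε1)/(o52-Bε0)] [cite: CossartPiltant2008, Prop. 4.2 (proof)] -/
theorem exists_stratumIff_of_iotaTau_eq_zero (k : Type) [Field k] [PerfectField k] [Algebra k A] [Algebra.FiniteType k A]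
    (𝔪 : Ideal A) [𝔪.IsPrime] (F : A) (hreg : IsRegularLocalRing (Localization.AtPrime 𝔪))
    (hdim : ringKrullDim (Localization.AtPrime 𝔪) = (3 : ℕ))
    (hF0 : algebraMap A (Localization.AtPrime 𝔪) F ≠ 0)
    (hF2 : algebraMap A (Localization.AtPrime 𝔪) F ∈ maximalIdeal (Localization.AtPrime 𝔪) ^ 2)
    (htop : ContactCylinder.topStratumPrime iotaOrdEpsTau (Localization.AtPrime 𝔪)
      (algebraMap A (Localization.AtPrime 𝔪) F) = maximalIdeal (Localization.AtPrime 𝔪))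
    (hτ : iotaTau (Localization.AtPrime 𝔪) (algebraMap A (Localization.AtPrime 𝔪) F) = 0) :
    ∃ h : A, h ∉ 𝔪 ∧ ∀ (𝔮 : Ideal A) [𝔮.IsPrime], h ∉ 𝔮 → ringKrullDim (Localization.AtPrime 𝔮) ≤ (3 : ℕ) →
      (𝔪 ≤ 𝔮 ↔
        (algebraMap A (Localization.AtPrime 𝔮) F ∈ maximalIdeal (Localization.AtPrime 𝔮) ^ 2 ∧
          iotaFlatT (Localization.AtPrime 𝔮) (algebraMap A (Localization.AtPrime 𝔮) F) =
            iotaFlatT (Localization.AtPrime 𝔪) (algebraMap A (Localization.AtPrime 𝔪) F))) := by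
  classical
  haveI : IsNoetherianRing A := Algebra.FiniteType.isNoetherianRing k A
  haveI := hreg
  -- the order `ν₀` and the letter `ε₀` at `𝔪`
  obtain ⟨ν₀, hν₀⟩ := Ordinal.lt_omega0.mp (iotaOrd_lt_omega0_of_ne_zero (Localization.AtPrime 𝔪) hF0)
  -- the regular basic open and the ideals of the superlevel sets
  obtain ⟨h₀, hh₀, hreg₀⟩ := GenericEquimultiplicity.exists_not_mem_forall_isRegularLocalRing k 𝔪 hreg
  obtain ⟨I, hI⟩ := GenericEquimultiplicity.husc_iotaOrd k hreg₀ F ν₀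
  obtain ⟨I₁, hI₁⟩ := GenericEquimultiplicity.husc_iotaOrd k hreg₀ F (ν₀ + 1)
  obtain ⟨I₂, hI₂⟩ := GenericEquimultiplicity.husc_iotaOrd k hreg₀ F 2
  obtain ⟨J, hIJ, hJ⟩ := exists_ideal_iotaEps_eq_one_iff k hreg₀ F ν₀ hI
  have hlt_iff : ∀ (𝔮 : Ideal A) [𝔮.IsPrime], h₀ ∉ 𝔮 →
      ((ν₀ : Ordinal) < iotaOrd (Localization.AtPrime 𝔮) (algebraMap A (Localization.AtPrime 𝔮) F) ↔ I₁ ≤ 𝔮) := by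
    intro 𝔮 _ h𝔮
    rw [← hI₁ 𝔮 h𝔮, Nat.cast_succ, ← Order.succ_le_iff, Order.succ_eq_add_one]
  -- `(ν₀ ; 1) ≤ (ν ; ε) ↔ I₁ J ≤ ·` and `(ν₀ ; 0) < (ν ; ε) ↔ I₁ J ≤ ·` (the same set)
  have hIJ_iff : ∀ (𝔮 : Ideal A) [𝔮.IsPrime], h₀ ∉ 𝔮 →
      (((ν₀ : Ordinal) < iotaOrd (Localization.AtPrime 𝔮) (algebraMap A (Localization.AtPrime 𝔮) F) ∨
        ((ν₀ : Ordinal) = iotaOrd (Localization.AtPrime 𝔮) (algebraMap A (Localization.AtPrime 𝔮) F) ∧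
          iotaEps (Localization.AtPrime 𝔮) (algebraMap A (Localization.AtPrime 𝔮) F) = 1)) ↔ I₁ * J ≤ 𝔮) := by
    intro 𝔮 _ h𝔮
    rw [Ideal.IsPrime.mul_le inferInstance, ← hlt_iff 𝔮 h𝔮]
    constructor
    · rintro (hlt | ⟨heq, hε1⟩)
      · exact Or.inl hlt
      · exact Or.inr ((hJ 𝔮 h𝔮 heq.symm).mp hε1)
    · rintro (hlt | hJ𝔮)
      · exact Or.inl hlt
      · have hν : (ν₀ : Ordinal) ≤ iotaOrd (Localization.AtPrime 𝔮) _ := (hI 𝔮 h𝔮).mpr (hIJ.trans hJ𝔮)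
        rcases hν.lt_or_eq with hlt | heq
        · exact Or.inl hlt
        · exact Or.inr ⟨heq, (hJ 𝔮 h𝔮 heq.symm).mpr hJ𝔮⟩
  -- the abstract spectrum lemma, `v = (ν ; ε)`, `Sg = (F ∈ 𝔪²)`, centre `𝔪`
  obtain ⟨h, hh𝔪, hiff⟩ := StratumIff.stratumIff_of_strat
    (fun x : PrimeSpectrum A => iotaOrdEps (Localization.AtPrime x.asIdeal) (algebraMap A (Localization.AtPrime x.asIdeal) F))
    (fun x : PrimeSpectrum A =>
      algebraMap A (Localization.AtPrime x.asIdeal) F ∈ maximalIdeal (Localization.AtPrime x.asIdeal) ^ 2)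
    ⟨𝔪, inferInstance⟩ h₀ hh₀
    (fun x y hy hxy => iotaOrdEps_localization_mono F x.asIdeal y.asIdeal hxy (hreg₀ _ hy))
    (by
      rcases iotaEps_eq_zero_or_eq_one (Localization.AtPrime 𝔪) (algebraMap A (Localization.AtPrime 𝔪) F) with hε | hε
      · refine ⟨I, fun x hx => ?_⟩
        change iotaOrdEps (Localization.AtPrime 𝔪) _ ≤ _ ↔ _
        rw [iotaOrdEps_le_iff, hν₀, hε, ← hI x.asIdeal hx]
        constructor
        · rintro (hlt | ⟨heq, -⟩)
          · exact hlt.le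
          · exact heq.le
        · intro hle
          rcases hle.lt_or_eq with hlt | heq
          · exact Or.inl hlt
          · exact Or.inr ⟨heq, zero_le⟩
      · refine ⟨I₁ * J, fun x hx => ?_⟩
        change iotaOrdEps (Localization.AtPrime 𝔪) _ ≤ _ ↔ _
        rw [iotaOrdEps_le_iff, hν₀, hε, ← hIJ_iff x.asIdeal hx]
        constructor
        · rintro (hlt | ⟨heq, hle⟩)
          · exact Or.inl hlt
          · exact Or.inr ⟨heq, le_antisymm (iotaEps_le_one _ _) hle⟩
        · rintro (hlt | ⟨heq, hε1⟩)
          · exact Or.inl hlt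
          · exact Or.inr ⟨heq, hε1.symm.le⟩)
    (by
      rcases iotaEps_eq_zero_or_eq_one (Localization.AtPrime 𝔪) (algebraMap A (Localization.AtPrime 𝔪) F) with hε | hε
      · refine ⟨I₁ * J, fun x hx => ?_⟩
        change iotaOrdEps (Localization.AtPrime 𝔪) _ < _ ↔ _
        rw [show iotaOrdEps = iotaLex Ordinal.omega0 iotaOrd iotaEps from rfl, iotaLex_lt_iff iotaEps_boundedBy_omega0,
          hν₀, hε, ← hIJ_iff x.asIdeal hx]
        constructor
        · rintro (hlt | ⟨heq, hlt0⟩)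
          · exact Or.inl hlt
          · refine Or.inr ⟨heq, ?_⟩
            rcases iotaEps_eq_zero_or_eq_one (Localization.AtPrime x.asIdeal)
              (algebraMap A (Localization.AtPrime x.asIdeal) F) with h0 | h1
            · exact absurd h0 (ne_of_gt hlt0)
            · exact h1
        · rintro (hlt | ⟨heq, hε1⟩)
          · exact Or.inl hlt
          · exact Or.inr ⟨heq, by rw [hε1]; exact zero_lt_one⟩
      · refine ⟨I₁, fun x hx => ?_⟩
        change iotaOrdEps (Localization.AtPrime 𝔪) _ < _ ↔ _
        rw [show iotaOrdEps = iotaLex Ordinal.omega0 iotaOrd iotaEps from rfl, iotaLex_lt_iff iotaEps_boundedBy_omega0,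
          hν₀, hε, ← hlt_iff x.asIdeal hx]
        constructor
        · rintro (hlt | ⟨-, hlt1⟩)
          · exact hlt
          · exact absurd (iotaEps_le_one _ _) (not_le.mpr hlt1)
        · exact fun hlt => Or.inl hlt)
    ⟨I₂, fun x hx => by
      have h2 := hI₂ x.asIdeal hx
      rw [Nat.cast_ofNat] at h2
      exact (StratumIff.mem_sq_iff_two_le_iotaOrd F x.asIdeal).trans h2⟩
    (fun x y hy hxy hx => by
      have hx' := (StratumIff.mem_sq_iff_two_le_iotaOrd F x.asIdeal).mp hx
      exact (StratumIff.mem_sq_iff_two_le_iotaOrd F y.asIdeal).mpr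
        (hx'.trans (StratumIff.iotaOrd_localization_mono F _ _ hxy (hreg₀ _ hy))))
    ⟨𝔪, inferInstance⟩ le_rfl hF2
    (fun x hx𝔪 _ => by
      constructor
      · intro hv
        -- a generization with the same `(ν ; ε)` has `τ = 0` ((c7) for `τ`), hence the same `ι₀`: it lies in the top stratum
        have hτx : iotaTau (Localization.AtPrime x.asIdeal) (algebraMap A (Localization.AtPrime x.asIdeal) F) = 0 :=
          le_antisymm ((iotaTau_localization_mono F x.asIdeal 𝔪 hx𝔪).trans hτ.le) zero_le
        have h0 : iotaOrdEpsTau (Localization.AtPrime x.asIdeal) (algebraMap A (Localization.AtPrime x.asIdeal) F) =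
            iotaOrdEpsTau (Localization.AtPrime 𝔪) (algebraMap A (Localization.AtPrime 𝔪) F) :=
          (iotaOrdEpsTau_eq_iff _ _ _ _).mpr ⟨hv, hτx.trans hτ.symm⟩
        obtain ⟨hprime, hcomap⟩ := StratumIff.isPrime_map_and_comap_map_eq 𝔪 x.asIdeal hx𝔪
        haveI := hprime
        have hmemtop : (⟨x.asIdeal.map (algebraMap A (Localization.AtPrime 𝔪)), hprime⟩ :
            PrimeSpectrum (Localization.AtPrime 𝔪)) ∈ ContactCylinder.topStratum iotaOrdEpsTau
              (Localization.AtPrime 𝔪) (algebraMap A (Localization.AtPrime 𝔪) F) := by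
          rw [ContactCylinder.mem_topStratum_iff]
          change iotaOrdEpsTau (Localization.AtPrime (x.asIdeal.map (algebraMap A (Localization.AtPrime 𝔪)))) _ = _
          rw [StratumIff.iota_localization_localization_eq iotaOrdEpsTau iotaOrdEpsTau_isoInvariant 𝔪 _ F,
            StratumIff.iota_localization_congr iotaOrdEpsTau hcomap F]
          exact h0
        have hle := ContactCylinder.topStratumPrime_le iotaOrdEpsTau (Localization.AtPrime 𝔪)
          (algebraMap A (Localization.AtPrime 𝔪) F) hmemtop
        rw [htop] at hle
        have hle' := Ideal.comap_mono (f := algebraMap A (Localization.AtPrime 𝔪)) hle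
        have h𝔪eq : Ideal.comap (algebraMap A (Localization.AtPrime 𝔪)) (maximalIdeal (Localization.AtPrime 𝔪)) = 𝔪 :=
          IsLocalization.AtPrime.under_maximalIdeal (Localization.AtPrime 𝔪) 𝔪
        rw [h𝔪eq] at hle'
        change 𝔪 ≤ (x.asIdeal.map (algebraMap A (Localization.AtPrime 𝔪))).comap _ at hle'
        rwa [hcomap] at hle'
      · intro h𝔪x
        have heq : x = ⟨𝔪, inferInstance⟩ := PrimeSpectrum.ext (le_antisymm hx𝔪 h𝔪x)
        subst heq
        rfl)
  refine ⟨h, hh𝔪, fun 𝔮 _ hh𝔮 hdim𝔮 => ?_⟩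
  have hq := hiff ⟨𝔮, inferInstance⟩ hh𝔮
  constructor
  · intro hle
    have heq : 𝔮 = 𝔪 := eq_of_le_of_ringKrullDim hle hdim hdim𝔮
    subst heq
    exact ⟨hF2, rfl⟩
  · rintro ⟨hSg, hflat⟩
    refine hq.mpr ⟨hSg, ?_⟩
    have h1 := ((iotaFlatT_eq_iff _ _ _ _).mp hflat).1
    exact ((iotaOrdEpsTau_eq_iff _ _ _ _).mp h1).1

end CrossingPoint

end Summit.ResolutionOfSingularities.ResolutionOfSingularities.Theorems

end
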